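import Summits.HubbardSuperconductivity.HubbardSuperconductivity.Theorems.AnisotropyChordTransferFibre3PairSplit
import Summits.HubbardSuperconductivity.HubbardSuperconductivity.Theorems.AnisotropyChordTransferFibre3KTAssemblyClosedRho

/-!
# Route `AnisotropyChord` / H0 rotor rung: (KT-2b) — `OffPoleTailFromPieces` and the x-mirror FOLD of `cs2`

PartN32 (`…Fibre3KT2bTargets`, theory seat `hubbard-h0-rotor-theory-1`, memo 21 §304(a)):
* **`offPoleTailFromPieces_holds (hL : 2 ≤ L) (Δ) : OffPoleTailFromPieces L Δ`** (from `pairSplitCS_holds` + `nTermBound_holds`);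
* the x-mirror `m(r) = (−rₓ, r_y)`: `A₋(a,b) = conj A₊(m a, m b)` (`Aminus_eq_conj`), `d₋(a) = d₊(m a)`, `D` is mirror invariant, hence for an
  x-mirror-symmetric profile **`cs2_fold`**: `cs2 f = Σ_{(a,b) ∉ D} d₊(a)² |A₊(a,b)|²` — the form in which THEOREM (KT-2b-cs2) (`Cs2RealSpaceBound`) is proved.
Prover seat `hubbard-h0-rotor-p1` g22; helper for stmt-HubbardSuperconductivity-19089 (`--supports`).
-/

set_option linter.dupNamespace false
set_option autoImplicit false

noncomputable section

open scoped BigOperators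
open Complex

namespace Summit.HubbardSuperconductivity.HubbardSuperconductivity.Theorems.AnisotropyChord.Transfer.Fibre3

variable (L : ℕ) [NeZero L]

/-- ★ **`OffPoleTailFromPieces L Δ` holds** (`L ≥ 2`). [folklore] -/
theorem offPoleTailFromPieces_holds (hL : 2 ≤ L) (Δ : ℝ) : OffPoleTailFromPieces L Δ :=
  offPoleTailFromPieces_of_pairSplit L Δ (pairSplitCS_holds L hL Δ)

/-! ## The x-mirror -/

/-- the x-mirror `(rₓ, r_y) ↦ (−rₓ, r_y)`. [folklore] -/
def mirror (r : Tor L) : Tor L := (-r.1, r.2)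

omit [NeZero L] in
/-- [folklore] -/
theorem mirror_mirror (r : Tor L) : mirror L (mirror L r) = r := by
  unfold mirror; simp

omit [NeZero L] in
/-- [folklore] -/
theorem mirror_sub (r s : Tor L) : mirror L (r - s) = mirror L r - mirror L s := by
  unfold mirror; ext <;> simp; ring

omit [NeZero L] in
/-- `m(r + x̂) = m(r) − x̂`. [folklore] -/
theorem mirror_add_K1 (r : Tor L) : mirror L (r + K1 L) = mirror L r - K1 L := by
  unfold mirror K1; ext <;> simp; ring

omit [NeZero L] in
/-- `m(r − x̂) = m(r) + x̂`. [folklore] -/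
theorem mirror_sub_K1 (r : Tor L) : mirror L (r - K1 L) = mirror L r + K1 L := by
  unfold mirror K1; ext <;> simp; ring

omit [NeZero L] in
/-- `m r = 0 ↔ r = 0`. [folklore] -/
theorem mirror_eq_zero (r : Tor L) : mirror L r = 0 ↔ r = 0 := by
  unfold mirror
  constructor
  · intro h
    have h1 := congrArg Prod.fst h
    have h2 := congrArg Prod.snd h
    simp only [Prod.fst_zero, Prod.snd_zero, neg_eq_zero] at h1 h2
    exact Prod.ext h1 h2
  · intro h; rw [h]; simp

omit [NeZero L] in
/-- `m` is injective. [folklore] -/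
theorem mirror_inj (r s : Tor L) : mirror L r = mirror L s ↔ r = s := by
  constructor
  · intro h
    have := congrArg (mirror L) h
    rwa [mirror_mirror, mirror_mirror] at this
  · intro h; rw [h]

/-- the mirror on configurations, an involution of `Cfg`. [folklore] -/
def mirrorCfg : Cfg L ≃ Cfg L where
  toFun c := (mirror L c.1, mirror L c.2)
  invFun c := (mirror L c.1, mirror L c.2)
  left_inv c := by simp only [mirror_mirror]
  right_inv c := by simp only [mirror_mirror]

/-- `e^{iθ(m a)ₓ} = conj e^{iθaₓ}`. [folklore] -/
theorem phase_K1_mirror (a : Tor L) : phase L (K1 L) (mirror L a) = (starRingEnd ℂ) (phase L (K1 L) a) := by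
  rw [conj_phase, phase_eq_phZ, phase_eq_phZ]
  congr 1
  unfold dotZ mirror K1
  simp

/-- `conj w₊ = w₋`. [folklore] -/
theorem conj_wplus : (starRingEnd ℂ) (wplus L) = wminus L := by
  unfold wplus wminus; rw [map_sub, map_one, conj_phase]

/-- `conj w₋ = w₊`. [folklore] -/
theorem conj_wminus : (starRingEnd ℂ) (wminus L) = wplus L := by
  unfold wplus wminus; rw [map_sub, map_one, conj_phase, neg_neg]

omit [NeZero L] in
/-- the hard core is mirror invariant. [folklore] -/
theorem InD_mirror (c : Cfg L) : InD L (mirror L c.1, mirror L c.2) = InD L c := by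
  unfold InD
  rw [Bool.decide_congr (mirror_eq_zero L c.1), Bool.decide_congr (mirror_eq_zero L c.2),
    Bool.decide_congr (mirror_inj L c.1 c.2)]

/-- **`A₋(a,b) = conj A₊(m a, m b)`** for an x-mirror-symmetric `f`. [folklore] -/
theorem Aminus_eq_conj {f : Tor L → ℝ} (hsym : ∀ r : Tor L, f (-r.1, r.2) = f r) (c : Cfg L) :
    Aminus L f c = (starRingEnd ℂ) (Aplus L f (mirror L c.1, mirror L c.2)) := by
  have hms : ∀ r : Tor L, f (mirror L r) = f r := fun r => hsym r
  unfold Aplus Aminus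
  simp only
  rw [← mirror_sub, show mirror L c.2 - K1 L = mirror L (c.2 + K1 L) by rw [mirror_add_K1],
    show mirror L (c.2 - c.1) + K1 L = mirror L (c.2 - c.1 - K1 L) by rw [mirror_sub_K1]]
  simp only [hms, phase_K1_mirror, map_add, map_mul, Complex.conj_ofReal, conj_wplus, conj_wminus, Complex.conj_conj]

/-- `|A₋(a,b)|² = |A₊(m a, m b)|²`. [folklore] -/
theorem normSq_Aminus {f : Tor L → ℝ} (hsym : ∀ r : Tor L, f (-r.1, r.2) = f r) (c : Cfg L) :
    Complex.normSq (Aminus L f c) = Complex.normSq (Aplus L f (mirror L c.1, mirror L c.2)) := by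
  rw [Aminus_eq_conj L hsym, Complex.normSq_conj]

omit [NeZero L] in
/-- `d₋(a) = d₊(m a)`. [folklore] -/
theorem dminus_eq {f : Tor L → ℝ} (hsym : ∀ r : Tor L, f (-r.1, r.2) = f r) (a : Tor L) :
    f a - f (a + K1 L) = f (mirror L a) - f (mirror L a - K1 L) := by
  have hms : ∀ r : Tor L, f (mirror L r) = f r := fun r => hsym r
  rw [← mirror_add_K1, hms, hms]

/-- the folded summand `1_{Dᶜ} d₊(a)² |A₊(a,b)|²`. [folklore] -/
def cs2term (f : Tor L → ℝ) (c : Cfg L) : ℝ :=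
  if InD L c then 0 else (f c.1 - f (c.1 - K1 L)) ^ 2 * Complex.normSq (Aplus L f c)

omit [NeZero L] in
/-- `cs2term ≥ 0`. [folklore] -/
theorem cs2term_nonneg (f : Tor L → ℝ) (c : Cfg L) : 0 ≤ cs2term L f c := by
  unfold cs2term; split_ifs
  · exact le_rfl
  · exact mul_nonneg (sq_nonneg _) (Complex.normSq_nonneg _)

/-- ★ **the fold:** `cs2 f = Σ_{(a,b) ∉ D} d₊(a)² |A₊(a,b)|²` for an x-mirror-symmetric `f`. [folklore] -/
theorem cs2_fold {f : Tor L → ℝ} (hsym : ∀ r : Tor L, f (-r.1, r.2) = f r) :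
    cs2 L f = ∑ c : Cfg L, cs2term L f c := by
  unfold cs2
  have hpt : ∀ c : Cfg L,
      (if InD L c then 0 else
        ((f c.1 - f (c.1 - K1 L)) ^ 2 * Complex.normSq (Aplus L f c)
          + (f c.1 - f (c.1 + K1 L)) ^ 2 * Complex.normSq (Aminus L f c)) / 2)
      = (1 / 2) * cs2term L f c + (1 / 2) * cs2term L f (mirrorCfg L c) := by
    intro c
    have hD : InD L (mirrorCfg L c) = InD L c := InD_mirror L c
    unfold cs2term
    rw [hD]
    split_ifs
    · simp
    · simp only [mirrorCfg, Equiv.coe_fn_mk]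
      rw [dminus_eq L hsym, normSq_Aminus L hsym]
      ring
  rw [Finset.sum_congr rfl fun c _ => hpt c, Finset.sum_add_distrib, ← Finset.mul_sum, ← Finset.mul_sum,
    ← Fintype.sum_equiv (mirrorCfg L) (fun c => cs2term L f (mirrorCfg L c)) (cs2term L f) (fun _ => rfl)]
  ring

/-- `cs2 ≥ 0` (every summand is a sum of squares times norms). [folklore] -/
theorem cs2_nonneg (f : Tor L → ℝ) : 0 ≤ cs2 L f := by
  unfold cs2
  refine Finset.sum_nonneg fun c _ => ?_
  split_ifs
  · exact le_rfl
  · have h1 := mul_nonneg (sq_nonneg (f c.1 - f (c.1 - K1 L))) (Complex.normSq_nonneg (Aplus L f c))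
    have h2 := mul_nonneg (sq_nonneg (f c.1 - f (c.1 + K1 L))) (Complex.normSq_nonneg (Aminus L f c))
    linarith

end Summit.HubbardSuperconductivity.HubbardSuperconductivity.Theorems.AnisotropyChord.Transfer.Fibre3

end
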